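import Summits.MatrixMultiplication.OmegaCensus.DominoStructure
import Summits.MatrixMultiplication.OmegaCensus.DihedralLikeTiling
import HarnessLib

/-!
# Structure theorem for domino cube law triples — the TPP statement

ω-census `pub-omega`, family (b3), seat pub-omega-group gen 6.  Framing: lottery ticket; floor = certified bounds/negative
ranges.  VALUE: a theorem about the group-theoretic method (TPP triples in dihedral-like groups); NOT progress on ω.

**Theorem (`domino_structure_of_law`).** Let `G` carry a dihedral-like presentation `ρ, τ : A → G` over a finite abelian
group `A` (`ρaρb = ρ(a+b)`, `ρaτb = τ(b−a)`, `τaρb = τ(a+b)`, `τaτb = ρ(c₀+b−a)`, ANY `c₀`), and let `(S, T, U)` be a TPP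
triple whose coset parts `X₀ = {a : ρa ∈ X}`, `X₁ = {a : τa ∈ X}` have sizes `(1,1 | d,d | e,e)` and which attains the law
`3|S||T||U| + 8 = 8|A|`.  Then `T₁ = κ − T₀` and `U₁ = κ′ − U₀` for some `κ, κ′ ∈ A`: each of `T`, `U` is a union of left
cosets of an order-two subgroup `{1, τk}` (the structure conjecture of the cell's gen-4 notes, all domino cube shapes).

Proof: the vertex-`000` and vertex-`111` near-tilings of `DihedralLikeVertexCounting` are, after translating by the two
points of `S`, exactly the additive system of `DominoStructure.domino_structure` for `(T₀ + b, T₁, U₀, U₁ − b)`,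
`b = s′ − s`.
-/

namespace Summit.MatrixMultiplication.OmegaCensus

open Literature.Combinatorics.Additive Finset

/-! ## Plumbing: singleton first factors and translations of two-fold sumsets -/

section Plumbing

variable {A : Type*} [AddCommGroup A] [DecidableEq A]

/-- A three-fold sumset with a singleton first factor is a translate of a two-fold sumset. [folklore] -/
theorem sumset₃_singleton (c : A) (X Y : Finset A) :
    ((({c} : Finset A) ×ˢ X ×ˢ Y).image fun p : A × A × A => p.1 + p.2.1 + p.2.2) =
      ((X ×ˢ Y).image fun p : A × A => p.1 + p.2).image (fun z => z + c) := by
  ext z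
  simp only [mem_image, mem_product, mem_singleton, Prod.exists]
  constructor
  · rintro ⟨a, x, y, ⟨rfl, hx, hy⟩, rfl⟩
    exact ⟨x + y, ⟨x, y, ⟨hx, hy⟩, rfl⟩, by abel⟩
  · rintro ⟨w, ⟨x, y, ⟨hx, hy⟩, rfl⟩, rfl⟩
    exact ⟨c, x, y, ⟨rfl, hx, hy⟩, by abel⟩

omit [DecidableEq A] in
/-- Directness of `{c} + X + Y` gives directness of `X + Y`. [folklore] -/
theorem injOn₂_of_injOn₃_singleton (c : A) (X Y : Finset A)
    (h : Set.InjOn (fun p : A × A × A => p.1 + p.2.1 + p.2.2) ↑(({c} : Finset A) ×ˢ X ×ˢ Y)) :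
    Set.InjOn (fun p : A × A => p.1 + p.2) ↑(X ×ˢ Y) := by
  rintro ⟨x, y⟩ hp ⟨x', y'⟩ hp' he
  simp only [coe_product, Set.mem_prod, mem_coe] at hp hp'
  change x + y = x' + y' at he
  have hm : (c, x, y) ∈ (↑(({c} : Finset A) ×ˢ X ×ˢ Y) : Set (A × A × A)) := by simp [hp.1, hp.2]
  have hm' : (c, x', y') ∈ (↑(({c} : Finset A) ×ˢ X ×ˢ Y) : Set (A × A × A)) := by simp [hp'.1, hp'.2]
  have := h hm hm' (by change c + x + y = c + x' + y'; rw [add_assoc, he, ← add_assoc])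
  simp only [Prod.mk.injEq, true_and] at this
  rw [this.1, this.2]

/-- Translating the left factor translates the sumset. [folklore] -/
theorem sumset₂_image_add_left (b : A) (X Y : Finset A) :
    (((X.image fun x => x + b) ×ˢ Y).image fun p : A × A => p.1 + p.2) =
      ((X ×ˢ Y).image fun p : A × A => p.1 + p.2).image (fun z => z + b) := by
  ext z
  simp only [mem_image, mem_product, Prod.exists]
  constructor
  · rintro ⟨x', y, ⟨⟨x, hx, rfl⟩, hy⟩, rfl⟩
    exact ⟨x + y, ⟨x, y, ⟨hx, hy⟩, rfl⟩, by abel⟩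
  · rintro ⟨w, ⟨x, y, ⟨hx, hy⟩, rfl⟩, rfl⟩
    exact ⟨x + b, y, ⟨⟨x, hx, rfl⟩, hy⟩, by abel⟩

/-- Translating the right factor translates the sumset. [folklore] -/
theorem sumset₂_image_add_right (b : A) (X Y : Finset A) :
    ((X ×ˢ (Y.image fun y => y + b)).image fun p : A × A => p.1 + p.2) =
      ((X ×ˢ Y).image fun p : A × A => p.1 + p.2).image (fun z => z + b) := by
  ext z
  simp only [mem_image, mem_product, Prod.exists]
  constructor
  · rintro ⟨x, y', ⟨hx, ⟨y, hy, rfl⟩⟩, rfl⟩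
    exact ⟨x + y, ⟨x, y, ⟨hx, hy⟩, rfl⟩, by abel⟩
  · rintro ⟨w, ⟨x, y, ⟨hx, hy⟩, rfl⟩, rfl⟩
    exact ⟨x, y + b, ⟨hx, ⟨y, hy, rfl⟩⟩, by abel⟩

/-- Composition of translations. [folklore] -/
theorem image_add_image_add (Z : Finset A) (b c : A) :
    (Z.image fun z => z + b).image (fun z => z + c) = Z.image fun z => z + (b + c) := by
  rw [image_image]; congr 1; funext z; simp only [Function.comp_apply]; abel

/-- Translation by `0`. [folklore] -/
theorem image_add_zero' (Z : Finset A) : (Z.image fun z => z + (0 : A)) = Z := by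
  simp

/-- Directness is translation invariant (left factor). [folklore] -/
theorem injOn_sumset₂_image_add_left (b : A) {X Y : Finset A}
    (h : Set.InjOn (fun p : A × A => p.1 + p.2) ↑(X ×ˢ Y)) :
    Set.InjOn (fun p : A × A => p.1 + p.2) ↑((X.image fun x => x + b) ×ˢ Y) := by
  rintro ⟨x₁, y⟩ hp ⟨x₂, y'⟩ hp' he
  simp only [coe_product, coe_image, Set.mem_prod, Set.mem_image, mem_coe] at hp hp'
  obtain ⟨⟨x, hx, rfl⟩, hy⟩ := hp
  obtain ⟨⟨x', hx', rfl⟩, hy'⟩ := hp'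
  change x + b + y = x' + b + y' at he
  have key : x + y = x' + y' := by
    have : x + b + y - b = x' + b + y' - b := by rw [he]
    calc x + y = x + b + y - b := by abel
      _ = x' + b + y' - b := this
      _ = x' + y' := by abel
  have hm : (x, y) ∈ (↑(X ×ˢ Y) : Set (A × A)) := by simp [hx, hy]
  have hm' : (x', y') ∈ (↑(X ×ˢ Y) : Set (A × A)) := by simp [hx', hy']
  have := h hm hm' key
  simp only [Prod.mk.injEq] at this
  rw [this.1, this.2]

/-- Directness is translation invariant (right factor). [folklore] -/
theorem injOn_sumset₂_image_add_right (b : A) {X Y : Finset A}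
    (h : Set.InjOn (fun p : A × A => p.1 + p.2) ↑(X ×ˢ Y)) :
    Set.InjOn (fun p : A × A => p.1 + p.2) ↑(X ×ˢ (Y.image fun y => y + b)) := by
  rintro ⟨x, y₁⟩ hp ⟨x', y₂⟩ hp' he
  simp only [coe_product, coe_image, Set.mem_prod, Set.mem_image, mem_coe] at hp hp'
  obtain ⟨hx, ⟨y, hy, rfl⟩⟩ := hp
  obtain ⟨hx', ⟨y', hy', rfl⟩⟩ := hp'
  change x + (y + b) = x' + (y' + b) at he
  have key : x + y = x' + y' := by
    calc x + y = x + (y + b) - b := by abel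
      _ = x' + (y' + b) - b := by rw [he]
      _ = x' + y' := by abel
  have hm : (x, y) ∈ (↑(X ×ˢ Y) : Set (A × A)) := by simp [hx, hy]
  have hm' : (x', y') ∈ (↑(X ×ˢ Y) : Set (A × A)) := by simp [hx', hy']
  have := h hm hm' key
  simp only [Prod.mk.injEq] at this
  rw [this.1, this.2]

/-- Cancelling a common translation in a disjointness statement. [folklore] -/
theorem disjoint_of_disjoint_image_add {Z W : Finset A} (c : A)
    (h : Disjoint (Z.image fun z => z + c) (W.image fun z => z + c)) : Disjoint Z W :=
  (disjoint_image (add_left_injective c)).1 h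

end Plumbing

/-! ## The theorem for TPP triples -/

section DihedralLike

variable {A : Type*} [AddCommGroup A] [DecidableEq A] [Fintype A] {G : Type} [Group G] [DecidableEq G]
  {ρ τ : A → G} {c₀ : A} {S T U : Finset G}

/-- **Structure of domino cube law triples.**  Dihedral-like `G` over `A` (any `c₀`); a TPP triple with coset part sizes
`(1,1 | d,d | e,e)` attaining `3|S||T||U| + 8 = 8|A|`.  Then the `τ`-part of `T` is a reflection `κ − T₀` of its
`ρ`-part, and likewise `U₁ = κ′ − U₀`. [folklore] -/
theorem domino_structure_of_law
    (hρρ : ∀ a b, ρ a * ρ b = ρ (a + b)) (hρτ : ∀ a b, ρ a * τ b = τ (b - a))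
    (hτρ : ∀ a b, τ a * ρ b = τ (a + b)) (hττ : ∀ a b, τ a * τ b = ρ (c₀ + b - a))
    (hρ : Function.Injective ρ) (hτ : Function.Injective τ) (hne : ∀ a b, ρ a ≠ τ b)
    (hsurj : ∀ g, (∃ a, ρ a = g) ∨ (∃ a, τ a = g)) (h : TripleProductProperty S T U)
    (hS₀ : (univ.filter fun a : A => ρ a ∈ S).card = 1) (hS₁ : (univ.filter fun a : A => τ a ∈ S).card = 1)
    (hT : (univ.filter fun a : A => ρ a ∈ T).card = (univ.filter fun a : A => τ a ∈ T).card)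
    (hU : (univ.filter fun a : A => ρ a ∈ U).card = (univ.filter fun a : A => τ a ∈ U).card)
    (hV : 3 * (S.card * T.card * U.card) + 8 = 8 * Fintype.card A) :
    ∃ κ κ' : A, (univ.filter fun a : A => τ a ∈ T) = (univ.filter fun a : A => ρ a ∈ T).image (fun b => κ - b) ∧
      (univ.filter fun a : A => τ a ∈ U) = (univ.filter fun a : A => ρ a ∈ U).image (fun b => κ' - b) := by
  set T₀ : Finset A := univ.filter fun a => ρ a ∈ T with hT₀
  set T₁ : Finset A := univ.filter fun a => τ a ∈ T with hT₁
  set U₀ : Finset A := univ.filter fun a => ρ a ∈ U with hU₀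
  set U₁ : Finset A := univ.filter fun a => τ a ∈ U with hU₁
  obtain ⟨s, hs⟩ := card_eq_one.1 hS₀
  obtain ⟨s', hs'⟩ := card_eq_one.1 hS₁
  -- membership facts for the sumset lemmas
  have mS₀ : ∀ a ∈ ({s} : Finset A), ρ a ∈ S := fun a ha => by
    have : a ∈ univ.filter fun a : A => ρ a ∈ S := by rw [hs]; exact ha
    simpa using this
  have mS₁ : ∀ a ∈ ({s'} : Finset A), τ a ∈ S := fun a ha => by
    have : a ∈ univ.filter fun a : A => τ a ∈ S := by rw [hs']; exact ha
    simpa using this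
  have mS₀c : ∀ a ∈ ({s} : Finset A), cond false (τ a) (ρ a) ∈ S := fun a ha => by simpa using mS₀ a ha
  have mS₁c : ∀ a ∈ ({s'} : Finset A), cond true (τ a) (ρ a) ∈ S := fun a ha => by simpa using mS₁ a ha
  have mT₀ : ∀ a ∈ T₀, ρ a ∈ T := fun a ha => by simpa [hT₀] using ha
  have mT₁ : ∀ a ∈ T₁, τ a ∈ T := fun a ha => by simpa [hT₁] using ha
  have mU₀ : ∀ a ∈ U₀, ρ a ∈ U := fun a ha => by simpa [hU₀] using ha
  have mU₁ : ∀ a ∈ U₁, τ a ∈ U := fun a ha => by simpa [hU₁] using ha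
  have mT₀c : ∀ a ∈ T₀, cond false (τ a) (ρ a) ∈ T := fun a ha => by simpa using mT₀ a ha
  have mT₁c : ∀ a ∈ T₁, cond true (τ a) (ρ a) ∈ T := fun a ha => by simpa using mT₁ a ha
  have mU₀c : ∀ a ∈ U₀, cond false (τ a) (ρ a) ∈ U := fun a ha => by simpa using mU₀ a ha
  have mU₁c : ∀ a ∈ U₁, cond true (τ a) (ρ a) ∈ U := fun a ha => by simpa using mU₁ a ha
  -- numerics
  have cS := card_eq_parts' hρ hτ hne hsurj S
  have cT := card_eq_parts' hρ hτ hne hsurj T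
  have cU := card_eq_parts' hρ hτ hne hsurj U
  rw [hS₀, hS₁] at cS
  have hprod : S.card * T.card * U.card = 8 * (T₀.card * U₀.card) := by
    rw [cS, cT, cU, ← hT, ← hU]; ring
  rw [hprod] at hV
  have hn : 3 * (T₀.card * U₀.card) + 1 = Fintype.card A := by omega
  have h3 : ¬ 3 ∣ Fintype.card A := by omega
  -- two-fold data
  set b : A := s' - s with hb
  have inj := sum_injOn' hρρ hττ hρ hτ h
  have i₀₀ := injOn₂_of_injOn₃_singleton s' T₀ U₀ (inj true false false mS₁c mT₀c mU₀c)
  have i₁₀ := injOn₂_of_injOn₃_singleton s T₁ U₀ (inj false true false mS₀c mT₁c mU₀c)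
  have i₀₁ := injOn₂_of_injOn₃_singleton s T₀ U₁ (inj false false true mS₀c mT₀c mU₁c)
  have i₁₁ := injOn₂_of_injOn₃_singleton s T₁ U₁ (inj false true true mS₀c mT₁c mU₁c)
  have d₁ := disjoint_sumset₁' hρρ hρτ hτρ hττ hne h false mS₁ mT₀ mU₀c mS₀ mT₁
  have d₄ := disjoint_sumset₁' hρρ hρτ hτρ hττ hne h true mS₁ mT₀ mU₁c mS₀ mT₁
  have d₃ := disjoint_sumset₂' hρρ hρτ hτρ hττ hne h false mS₀c mT₁ mU₀ mS₀c mT₀ mU₁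
  have d₂ := disjoint_sumset₃' hρρ hρτ hτρ hττ hne h false mS₀ mT₀c mU₁ mS₁ mU₀
  have d₅ := disjoint_sumset₃' hρρ hρτ hτρ hττ hne h true mS₀ mT₁c mU₁ mS₁ mU₀
  rw [sumset₃_singleton, sumset₃_singleton] at d₁ d₂ d₃ d₄ d₅
  -- translated sets
  set T₀' : Finset A := T₀.image fun x => x + b with hT₀'
  set U₁' : Finset A := U₁.image fun y => y + -b with hU₁'
  have es' : s' = b + s := by rw [hb]; abel
  have es : s = -b + s' := by rw [hb]; abel
  have key := domino_structure h3 (T₀ := T₀') (T₁ := T₁) (U₀ := U₀) (U₁ := U₁')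
    (by rw [hT₀', card_image_of_injective _ (add_left_injective b), hT])
    (by rw [hU₁', card_image_of_injective _ (add_left_injective (-b)), hU])
    (by rw [hT₀', card_image_of_injective _ (add_left_injective b)]; exact hn)
    (injOn_sumset₂_image_add_left b i₀₀) i₁₀
    (injOn_sumset₂_image_add_left b (injOn_sumset₂_image_add_right (-b) i₀₁))
    (injOn_sumset₂_image_add_right (-b) i₁₁)
    (by
      rw [hT₀', sumset₂_image_add_left]
      refine disjoint_of_disjoint_image_add s ?_
      rw [image_add_image_add, ← es']; exact d₁)
    (by
      rw [hT₀', hU₁', sumset₂_image_add_left, sumset₂_image_add_left, sumset₂_image_add_right, image_add_image_add,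
        neg_add_cancel, image_add_zero']
      refine disjoint_of_disjoint_image_add s ?_
      rw [image_add_image_add, ← es']; exact d₂.symm)
    (by
      rw [hT₀', hU₁', sumset₂_image_add_left, sumset₂_image_add_right, image_add_image_add, neg_add_cancel,
        image_add_zero']
      exact disjoint_of_disjoint_image_add s d₃)
    (by
      rw [hT₀', hU₁', sumset₂_image_add_left, sumset₂_image_add_right, sumset₂_image_add_right, image_add_image_add,
        neg_add_cancel, image_add_zero']
      refine disjoint_of_disjoint_image_add s' ?_
      rw [image_add_image_add, ← es]; exact d₄.symm)
    (by
      rw [hU₁', sumset₂_image_add_right]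
      refine disjoint_of_disjoint_image_add s' ?_
      rw [image_add_image_add, ← es]; exact d₅)
  obtain ⟨κ, κ', hκ, hκ'⟩ := key
  refine ⟨κ - b, κ' + b, ?_, ?_⟩
  · rw [hκ, hT₀', image_image]; congr 1; funext a; simp only [Function.comp_apply]; abel
  · have e : U₁ = U₁'.image fun y => y + b := by rw [hU₁', image_add_image_add, neg_add_cancel, image_add_zero']
    rw [e, hκ', image_image]; congr 1; funext a; simp only [Function.comp_apply]; abel

end DihedralLike

end Summit.MatrixMultiplication.OmegaCensus
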